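import Summits.QuantumAdvantage.QuantumAdvantage.Theorems.CubicForrelationNearExactIsExactTwelveLevelSixGammaH3

/-!
# Crux `CubicForrelation.NearExactIsExact` (stmt-QuantumAdvantage-14043) — n = 12 AT `Φ = 29/32`, level-6 configuration (γ):
  the bad set `A = {x ∉ Z : 4 ∤ e}` is EMPTY or ONE 6-FLAT of 64 points carrying the whole off-flat energy; and `A = ∅` is dead

Certificate seat `b2b-cforr-cert` (gen 25).  HONEST FRAMING: finite-slice lemmas (standard axioms, no `decide`) about cubic Boolean pairs on
12 bits; the second brick for killing configuration (γ) of `tw23_boundary_reduction2` (plan HOME/b2b-cforr-cert-g25/PROOF-N12-928-GAMMA.md).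
They do NOT decide (γ) and claim NO value of `θ₁₂`.  NOT summit progress.

Setting: cubic `f, g`, `W_g = 64u''`, `Z = {u'' even} = x_Z ⊕ V₀` a 9-flat, `e = u'' − (−1)^f`, off-flat energy `Σ_{x∉Z} e² ≤ 256`.
* `gl_A_coset64`: by the line congruence `gh_line` (every 4-flat with directions in `V₀` has `4 ∣ Σ e`) and one round of wild-point parity
  (`ws_erm_round`, `r = 3`) the set `A` meets every off-`Z` coset in `0` or `≥ 64` points.
* `gl_dichotomy`: hence EITHER `4 ∣ e` everywhere off `Z`, OR `A` lies in one coset, has exactly `64` points, `e² = 4` on `A` and `e = 0` on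
  `Zᶜ ∖ A` (budget `4·64 = 256`).
* `gl_div4_false`: the first alternative is impossible at off-flat energy exactly `256` against a level-6 partner (`e² = 1` on `Z`): then
  `{8 ∤ e} ∖ Z` has `≤ 16` points and `Σ_{x∉Z}|e| ≤ 64`, so gen 23's `tw23_levelSix_gamma_small_false` applies verbatim.
* `gl_M_flat`: in the second alternative `A` is a 6-FLAT `m₀ ⊕ U`, `U ≤ V₀`, `#U = 64` (`gh_line` makes all 4-flat sections of `A` even;
  `emf_flat_of_even_sections`).
What is left of (γ) after this file: `A` a 6-flat with `e = ±2` on it — killed in the next files by the rank analysis of `σ = e|_Z`.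

References: MacWilliams–Sloane (1977) Ch. 13 §3–§4; R. O'Donnell (2014) §1.4.  Axioms: the standard three.
-/

set_option linter.dupNamespace false -- D-0017: single-problem summit ⇒ `QuantumAdvantage.QuantumAdvantage` by design

noncomputable section

namespace Summit.QuantumAdvantage.QuantumAdvantage.Theorems.CubicForrelation.NearExactIsExact

open Finset
open Literature.Computability.QuantumComplexity
open Literature.Computability.QuantumComplexity.BuzetChailloux (bxor zeroVec bxor_bxor_cancel_left bxor_zeroVec zeroVec_bxor bxor_comm
  bxor_self)
open Literature.Computability.QuantumComplexity.DerivativeWalsh (W)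

/-! ### `A` meets every off-`Z` coset in `0` or `≥ 64` points -/

/-- **`A ∩ (c ⊕ V₀)` is empty or has at least `64` points** for every off-`Z` coset (`gh_line` + `ws_erm_round` with `r = 3`: the odd set of
`e/2` on the coset has even intersection with every 4-flat, so it is a word of the Reed–Muller code of order `9 − 4 = 5`… of minimum weight
`2⁶`). [this work] -/
theorem gl_A_coset64 (f g : (Fin (6 + 6) → Bool) → Bool) (hf : IsDegLeFun 3 f) (hg : IsDegLeFun 3 g)
    (u'' : (Fin (6 + 6) → Bool) → ℤ) (hu'' : ∀ x, W (fun y => signOf (g y)) x = (2 : ℝ) ^ 6 * (u'' x : ℝ))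
    (V₀ : Finset (Fin (6 + 6) → Bool)) (xZ : Fin (6 + 6) → Bool) (h0 : zeroVec ∈ V₀)
    (hadd : ∀ a ∈ V₀, ∀ b ∈ V₀, bxor a b ∈ V₀) (hcardV : #V₀ = 512)
    (hS : (univ.filter fun x : Fin (6 + 6) → Bool => ¬ Odd (u'' x)) = V₀.image (bxor xZ))
    (hoff : ∑ y ∈ univ.filter (fun y => y ∉ (univ.filter fun x : Fin (6 + 6) → Bool => ¬ Odd (u'' x))), (u'' y - sZ (f y)) ^ 2 ≤ 256)
    (c : Fin (6 + 6) → Bool) (hc : c ∉ (univ.filter fun x : Fin (6 + 6) → Bool => ¬ Odd (u'' x))) :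
    (∀ y ∈ V₀.image (bxor c), (4 : ℤ) ∣ u'' y - sZ (f y)) ∨
      64 ≤ #((V₀.image (bxor c)).filter fun y => ¬ (4 : ℤ) ∣ u'' y - sZ (f y)) := by
  classical
  set Z := univ.filter (fun x : Fin (6 + 6) → Bool => ¬ Odd (u'' x)) with hZdef
  set e : (Fin (6 + 6) → Bool) → ℤ := fun x => u'' x - sZ (f x) with hedef
  have hcardV9 : #V₀ = 2 ^ 9 := by rw [hcardV]; norm_num
  have hPV' : ∀ x, x ∉ Z → ∀ a ∈ V₀, bxor x a ∉ Z := fun x hx a ha => fl1_coset_out' hadd hS hx ha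
  have hcos_out : ∀ b ∈ V₀.image (bxor c), b ∉ Z := by
    intro b hb
    obtain ⟨v, hv, rfl⟩ := mem_image.1 hb
    exact hPV' c hc v hv
  have hp2 : ∀ y, y ∉ Z → e y = 2 * (e y / 2) := fun y hy =>
    (Int.mul_ediv_cancel' (even_iff_two_dvd.1 (gh_even_off f u'' y hy))).symm
  rcases ws_erm_round V₀ h0 hadd hcardV9 c (fun y => e y / 2) 3 (fun b hb a ha => by
      have hpts : ∀ ε : Fin (3 + 1) → Bool, (fun j => b j ^^ decide (Odd #(univ.filter fun i => ε i && a i j))) ∉ Z :=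
        fun ε => ws_flatPt_mem V₀ h0 (· ∉ Z) hPV' (3 + 1) b (hcos_out b hb) a ha ε
      have h4 := gh_line f g hf hg u'' hu'' V₀ xZ h0 hadd hcardV hS hoff b (a 0) (a 1) (a 2) (a 3) (ha 0) (ha 1) (ha 2) (ha 3)
      have ea : (![a 0, a 1, a 2, a 3] : Fin 4 → Fin (6 + 6) → Bool) = a := by
        funext i; fin_cases i <;> rfl
      rw [ea] at h4
      change (4 : ℤ) ∣ ∑ ε : Fin (3 + 1) → Bool, e (fun j => b j ^^ decide (Odd #(univ.filter fun i => ε i && a i j))) at h4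
      rw [sum_congr rfl fun ε _ => hp2 _ (hpts ε), ← mul_sum] at h4
      obtain ⟨k, hk⟩ := h4
      exact ⟨k, by linarith⟩) with hev | hbig
  · left
    intro y hy
    obtain ⟨k, hk⟩ := hev y hy
    have h2 := hp2 y (hcos_out y hy)
    refine ⟨k, ?_⟩
    simp only [e] at hk h2
    omega
  · right
    show 64 ≤ #((V₀.image (bxor c)).filter fun y => ¬ (4 : ℤ) ∣ e y)
    have e1 : ((V₀.image (bxor c)).filter fun x => Odd (e x / 2)) = (V₀.image (bxor c)).filter fun y => ¬ (4 : ℤ) ∣ e y := by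
      refine filter_congr fun y hy => ?_
      have h2 := hp2 y (hcos_out y hy)
      constructor
      · intro hodd h4
        obtain ⟨k, hk⟩ := h4
        rw [Int.odd_iff] at hodd
        omega
      · intro h4
        rw [Int.odd_iff]
        by_contra hne
        exact h4 ⟨e y / 2 / 2, by omega⟩
    rw [e1] at hbig
    norm_num at hbig
    omega

/-! ### The dichotomy -/

/-- **Dichotomy for the bad set.**  With off-flat energy `≤ 256`: either `4 ∣ e` everywhere off `Z`, or for some off-`Z` base point `c` the
set `M = {y ∈ c ⊕ V₀ : 4 ∤ e(y)}` has exactly `64` points, contains every off-`Z` point with `4 ∤ e`, and `e² = 4` on `M`, `e = 0` on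
`Zᶜ ∖ M` (`gl_A_coset64` and the budget `4·64 = 256`). [this work] -/
theorem gl_dichotomy (f g : (Fin (6 + 6) → Bool) → Bool) (hf : IsDegLeFun 3 f) (hg : IsDegLeFun 3 g)
    (u'' : (Fin (6 + 6) → Bool) → ℤ) (hu'' : ∀ x, W (fun y => signOf (g y)) x = (2 : ℝ) ^ 6 * (u'' x : ℝ))
    (V₀ : Finset (Fin (6 + 6) → Bool)) (xZ : Fin (6 + 6) → Bool) (h0 : zeroVec ∈ V₀)
    (hadd : ∀ a ∈ V₀, ∀ b ∈ V₀, bxor a b ∈ V₀) (hcardV : #V₀ = 512)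
    (hS : (univ.filter fun x : Fin (6 + 6) → Bool => ¬ Odd (u'' x)) = V₀.image (bxor xZ))
    (hoff : ∑ y ∈ univ.filter (fun y => y ∉ (univ.filter fun x : Fin (6 + 6) → Bool => ¬ Odd (u'' x))), (u'' y - sZ (f y)) ^ 2 ≤ 256) :
    (∀ y, y ∉ (univ.filter fun x : Fin (6 + 6) → Bool => ¬ Odd (u'' x)) → (4 : ℤ) ∣ u'' y - sZ (f y)) ∨
    ∃ c : Fin (6 + 6) → Bool, c ∉ (univ.filter fun x : Fin (6 + 6) → Bool => ¬ Odd (u'' x)) ∧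
      #((V₀.image (bxor c)).filter fun y => ¬ (4 : ℤ) ∣ u'' y - sZ (f y)) = 64 ∧
      (∀ y, y ∉ (univ.filter fun x : Fin (6 + 6) → Bool => ¬ Odd (u'' x)) → ¬ (4 : ℤ) ∣ u'' y - sZ (f y) →
        y ∈ (V₀.image (bxor c)).filter fun y => ¬ (4 : ℤ) ∣ u'' y - sZ (f y)) ∧
      (∀ y ∈ (V₀.image (bxor c)).filter (fun y => ¬ (4 : ℤ) ∣ u'' y - sZ (f y)), (u'' y - sZ (f y)) ^ 2 = 4) ∧
      (∀ y, y ∉ (univ.filter fun x : Fin (6 + 6) → Bool => ¬ Odd (u'' x)) →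
        y ∉ ((V₀.image (bxor c)).filter fun y => ¬ (4 : ℤ) ∣ u'' y - sZ (f y)) → u'' y - sZ (f y) = 0) := by
  classical
  set Z := univ.filter (fun x : Fin (6 + 6) → Bool => ¬ Odd (u'' x)) with hZdef
  set e : (Fin (6 + 6) → Bool) → ℤ := fun x => u'' x - sZ (f x) with hedef
  by_cases hall : ∀ y, y ∉ Z → (4 : ℤ) ∣ e y
  · exact Or.inl hall
  right
  push Not at hall
  obtain ⟨c, hc, hc4⟩ := hall
  have hPV' : ∀ x, x ∉ Z → ∀ a ∈ V₀, bxor x a ∉ Z := fun x hx a ha => fl1_coset_out' hadd hS hx ha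
  have hcos_out : ∀ b ∈ V₀.image (bxor c), b ∉ Z := by
    intro b hb
    obtain ⟨v, hv, rfl⟩ := mem_image.1 hb
    exact hPV' c hc v hv
  set T := (V₀.image (bxor c)).filter (fun y => ¬ (4 : ℤ) ∣ e y) with hTdef
  have hT64 : 64 ≤ #T := by
    rcases gl_A_coset64 f g hf hg u'' hu'' V₀ xZ h0 hadd hcardV hS hoff c hc with h | h
    · exact absurd (h c (mem_image.2 ⟨zeroVec, h0, bxor_zeroVec c⟩)) hc4
    · exact h
  have hToff : ∀ y ∈ T, y ∉ Z := fun y hy => hcos_out _ (mem_filter.1 hy).1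
  have hT4 : ∀ y ∈ T, (4 : ℤ) ≤ e y ^ 2 := by
    intro y hy
    obtain ⟨m, hm⟩ := gh_even_off f u'' y (hToff y hy)
    have hm0 : m ≠ 0 := by
      rintro rfl
      apply (mem_filter.1 hy).2
      exact ⟨0, by show u'' y - sZ (f y) = 4 * 0; rw [hm]; ring⟩
    have : e y ≤ -2 ∨ 2 ≤ e y := by
      show u'' y - sZ (f y) ≤ -2 ∨ 2 ≤ u'' y - sZ (f y); omega
    have := tp_sq_ge (k := 2) (by norm_num) this
    linarith
  -- split the off-flat energy along `T`
  set rest := (univ.filter fun y : Fin (6 + 6) → Bool => y ∉ Z).filter (fun y => y ∉ T) with hrest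
  have hsplit : ∑ y ∈ univ.filter (fun y => y ∉ Z), e y ^ 2 = ∑ y ∈ T, e y ^ 2 + ∑ y ∈ rest, e y ^ 2 := by
    rw [← sum_filter_add_sum_filter_not (univ.filter fun y : Fin (6 + 6) → Bool => y ∉ Z) (fun y => y ∈ T)]
    congr 1
    refine sum_congr ?_ fun _ _ => rfl
    ext y
    simp only [mem_filter, mem_univ, true_and]
    exact ⟨fun h => h.2, fun h => ⟨hToff y h, h⟩⟩
  have hTge : (4 : ℤ) * #T ≤ ∑ y ∈ T, e y ^ 2 := by
    calc (4 : ℤ) * #T = ∑ y ∈ T, (4 : ℤ) := by rw [sum_const, nsmul_eq_mul, mul_comm]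
      _ ≤ ∑ y ∈ T, e y ^ 2 := sum_le_sum hT4
  have hrest0 : 0 ≤ ∑ y ∈ rest, e y ^ 2 := sum_nonneg fun _ _ => sq_nonneg _
  have hoff' : ∑ y ∈ univ.filter (fun y => y ∉ Z), e y ^ 2 ≤ 256 := hoff
  have hT64' : (64 : ℤ) ≤ #T := by exact_mod_cast hT64
  have hTeq : #T = 64 := by
    have : (#T : ℤ) ≤ 64 := by linarith
    have : #T ≤ 64 := by exact_mod_cast this
    omega
  -- tightness: `e = 0` on the rest, `e² = 4` on `T`
  have hrest_zero : ∀ y ∈ rest, e y = 0 := by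
    have hz : ∑ y ∈ rest, e y ^ 2 = 0 := by linarith
    intro y hy
    have := (sum_eq_zero_iff_of_nonneg fun _ _ => sq_nonneg _).1 hz y hy
    exact pow_eq_zero_iff (two_ne_zero) |>.1 this
  have hT_four : ∀ y ∈ T, e y ^ 2 = 4 := by
    have hz : ∑ y ∈ T, (e y ^ 2 - 4) = 0 := by
      rw [sum_sub_distrib, sum_const, nsmul_eq_mul, hTeq]
      push_cast
      linarith
    intro y hy
    have := (sum_eq_zero_iff_of_nonneg fun y hy => by linarith [hT4 y hy]).1 hz y hy
    linarith
  have hzero : ∀ y, y ∉ Z → y ∉ T → e y = 0 := fun y hy hyT =>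
    hrest_zero y (mem_filter.2 ⟨mem_filter.2 ⟨mem_univ _, hy⟩, hyT⟩)
  refine ⟨c, hc, hTeq, ?_, hT_four, hzero⟩
  intro y hy hy4
  by_contra hyT
  apply hy4
  have := hzero y hy hyT
  simp only [e] at this
  rw [this]
  exact dvd_zero _

/-! ### `4 ∣ e` off `Z` is impossible at off-flat energy `256` -/

/-- **The first alternative is dead.**  Cubic `f, g`, `W_g = 64u''`, `W_f = 64w_f`, `Z` the 9-flat with `e² = 1` on it, off-flat energy exactly
`256` and `4 ∣ e` off `Z`: then the non-8-divisible off-`Z` points are `≤ 16` and `Σ_{x∉Z}|e| ≤ 64 < 128`, so `tw23_levelSix_gamma_small_false`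
applies. [this work] -/
theorem gl_div4_false (f g : (Fin (6 + 6) → Bool) → Bool) (hf : IsDegLeFun 3 f) (hg : IsDegLeFun 3 g)
    (u'' : (Fin (6 + 6) → Bool) → ℤ) (hu'' : ∀ x, W (fun y => signOf (g y)) x = (2 : ℝ) ^ 6 * (u'' x : ℝ))
    (V₀ : Finset (Fin (6 + 6) → Bool)) (xZ : Fin (6 + 6) → Bool) (h0 : zeroVec ∈ V₀) (hadd : ∀ a ∈ V₀, ∀ b ∈ V₀, bxor a b ∈ V₀)
    (hcardV : #V₀ = 512) (hS : (univ.filter fun x : Fin (6 + 6) → Bool => ¬ Odd (u'' x)) = V₀.image (bxor xZ))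
    (hZ1 : ∀ x ∈ (univ.filter fun x : Fin (6 + 6) → Bool => ¬ Odd (u'' x)), (u'' x - sZ (f x)) ^ 2 = 1)
    (hoff : ∑ y ∈ univ.filter (fun y => y ∉ (univ.filter fun x : Fin (6 + 6) → Bool => ¬ Odd (u'' x))), (u'' y - sZ (f y)) ^ 2 = 256)
    (h4 : ∀ y, y ∉ (univ.filter fun x : Fin (6 + 6) → Bool => ¬ Odd (u'' x)) → (4 : ℤ) ∣ u'' y - sZ (f y))
    (wf : (Fin (6 + 6) → Bool) → ℤ) (hwf : ∀ y, W (fun x => signOf (f x)) y = (2 : ℝ) ^ 6 * (wf y : ℝ)) : False := by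
  classical
  set Z := univ.filter (fun x : Fin (6 + 6) → Bool => ¬ Odd (u'' x)) with hZdef
  set e : (Fin (6 + 6) → Bool) → ℤ := fun x => u'' x - sZ (f x) with hedef
  set Bd := univ.filter (fun y : Fin (6 + 6) → Bool => y ∉ Z ∧ ¬ (8 : ℤ) ∣ e y) with hBddef
  have hBd : ∀ y, y ∉ Z → y ∉ Bd → (8 : ℤ) ∣ u'' y - sZ (f y) := by
    intro y hy hyB
    by_contra h8
    exact hyB (mem_filter.2 ⟨mem_univ _, hy, h8⟩)
  have h16 : ∀ y ∈ Bd, (16 : ℤ) ≤ e y ^ 2 := by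
    intro y hy
    obtain ⟨hyZ, hy8⟩ := (mem_filter.1 hy).2
    obtain ⟨m, hm⟩ := h4 y hyZ
    have hm2 : ¬ (2 : ℤ) ∣ m := by
      rintro ⟨m', rfl⟩
      exact hy8 ⟨m', by simp only [e]; rw [hm]; ring⟩
    have : e y ≤ -4 ∨ 4 ≤ e y := by simp only [e]; omega
    have := tp_sq_ge (k := 4) (by norm_num) this
    linarith
  have hc : #Bd ≤ 31 := by
    have h1 : (16 : ℤ) * #Bd ≤ 256 := by
      calc (16 : ℤ) * #Bd = ∑ y ∈ Bd, (16 : ℤ) := by rw [sum_const, nsmul_eq_mul, mul_comm]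
        _ ≤ ∑ y ∈ Bd, e y ^ 2 := sum_le_sum h16
        _ ≤ ∑ y ∈ univ.filter (fun y => y ∉ Z), e y ^ 2 :=
            sum_le_sum_of_subset_of_nonneg (fun y hy => mem_filter.2 ⟨mem_univ _, (mem_filter.1 hy).2.1⟩) fun _ _ _ => sq_nonneg _
        _ = 256 := hoff
    have : (#Bd : ℤ) ≤ 16 := by linarith
    have : #Bd ≤ 16 := by exact_mod_cast this
    omega
  have hl1 : ∑ y ∈ univ.filter (fun y => y ∉ Z), |u'' y - sZ (f y)| < 128 := by
    have hpt : ∀ y ∈ univ.filter (fun y : Fin (6 + 6) → Bool => y ∉ Z), 4 * |e y| ≤ e y ^ 2 := by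
      intro y hy
      obtain ⟨m, hm⟩ := h4 y (mem_filter.1 hy).2
      have hm' : e y = 4 * m := hm
      rw [hm', abs_mul, abs_of_nonneg (by norm_num : (0 : ℤ) ≤ 4)]
      by_cases hm0 : m = 0
      · rw [hm0]; norm_num
      · have : m ≤ -1 ∨ 1 ≤ m := by omega
        rcases this with h | h
        · rw [abs_of_neg (by linarith)]; nlinarith
        · rw [abs_of_pos (by linarith)]; nlinarith
    have hsum : 4 * ∑ y ∈ univ.filter (fun y => y ∉ Z), |e y| ≤ 256 := by
      rw [mul_sum]
      calc ∑ y ∈ univ.filter (fun y => y ∉ Z), 4 * |e y| ≤ ∑ y ∈ univ.filter (fun y => y ∉ Z), e y ^ 2 := sum_le_sum hpt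
        _ = 256 := hoff
    have : ∑ y ∈ univ.filter (fun y => y ∉ Z), |e y| ≤ 64 := by linarith
    exact lt_of_le_of_lt this (by norm_num)
  exact tw23_levelSix_gamma_small_false f g hf hg u'' hu'' V₀ xZ h0 hadd hcardV hS hZ1 Bd hBd hc hl1 hoff wf hwf

/-! ### In the second alternative `A` is a 6-flat -/

/-- **`A` is a 6-flat.**  If `M = {y ∈ c ⊕ V₀ : 4 ∤ e}` (`c ∉ Z`) has `64` points, `e² = 4` on `M` and `e = 0` on `Zᶜ ∖ M`, then
`U = {a ∈ V₀ : M ⊕ a = M}` is an xor-closed subgroup with `64` elements and `M = m₀ ⊕ U` for every `m₀ ∈ M` (all 4-flat sections of `M`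
are even by `gh_line`; `emf_flat_of_even_sections`). [this work] -/
theorem gl_M_flat (f g : (Fin (6 + 6) → Bool) → Bool) (hf : IsDegLeFun 3 f) (hg : IsDegLeFun 3 g)
    (u'' : (Fin (6 + 6) → Bool) → ℤ) (hu'' : ∀ x, W (fun y => signOf (g y)) x = (2 : ℝ) ^ 6 * (u'' x : ℝ))
    (V₀ : Finset (Fin (6 + 6) → Bool)) (xZ : Fin (6 + 6) → Bool) (h0 : zeroVec ∈ V₀)
    (hadd : ∀ a ∈ V₀, ∀ b ∈ V₀, bxor a b ∈ V₀) (hcardV : #V₀ = 512)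
    (hS : (univ.filter fun x : Fin (6 + 6) → Bool => ¬ Odd (u'' x)) = V₀.image (bxor xZ))
    (hoff : ∑ y ∈ univ.filter (fun y => y ∉ (univ.filter fun x : Fin (6 + 6) → Bool => ¬ Odd (u'' x))), (u'' y - sZ (f y)) ^ 2 ≤ 256)
    (c : Fin (6 + 6) → Bool) (hc : c ∉ (univ.filter fun x : Fin (6 + 6) → Bool => ¬ Odd (u'' x)))
    (hM64 : #((V₀.image (bxor c)).filter fun y => ¬ (4 : ℤ) ∣ u'' y - sZ (f y)) = 64)
    (hM4 : ∀ y ∈ (V₀.image (bxor c)).filter (fun y => ¬ (4 : ℤ) ∣ u'' y - sZ (f y)), (u'' y - sZ (f y)) ^ 2 = 4)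
    (hM0 : ∀ y, y ∉ (univ.filter fun x : Fin (6 + 6) → Bool => ¬ Odd (u'' x)) →
      y ∉ ((V₀.image (bxor c)).filter fun y => ¬ (4 : ℤ) ∣ u'' y - sZ (f y)) → u'' y - sZ (f y) = 0) :
    zeroVec ∈ V₀.filter (fun a => ∀ x ∈ ((V₀.image (bxor c)).filter fun y => ¬ (4 : ℤ) ∣ u'' y - sZ (f y)),
      bxor x a ∈ ((V₀.image (bxor c)).filter fun y => ¬ (4 : ℤ) ∣ u'' y - sZ (f y))) ∧
    (∀ a ∈ V₀.filter (fun a => ∀ x ∈ ((V₀.image (bxor c)).filter fun y => ¬ (4 : ℤ) ∣ u'' y - sZ (f y)),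
        bxor x a ∈ ((V₀.image (bxor c)).filter fun y => ¬ (4 : ℤ) ∣ u'' y - sZ (f y))),
      ∀ b ∈ V₀.filter (fun a => ∀ x ∈ ((V₀.image (bxor c)).filter fun y => ¬ (4 : ℤ) ∣ u'' y - sZ (f y)),
        bxor x a ∈ ((V₀.image (bxor c)).filter fun y => ¬ (4 : ℤ) ∣ u'' y - sZ (f y))),
      bxor a b ∈ V₀.filter (fun a => ∀ x ∈ ((V₀.image (bxor c)).filter fun y => ¬ (4 : ℤ) ∣ u'' y - sZ (f y)),
        bxor x a ∈ ((V₀.image (bxor c)).filter fun y => ¬ (4 : ℤ) ∣ u'' y - sZ (f y)))) ∧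
    #(V₀.filter (fun a => ∀ x ∈ ((V₀.image (bxor c)).filter fun y => ¬ (4 : ℤ) ∣ u'' y - sZ (f y)),
      bxor x a ∈ ((V₀.image (bxor c)).filter fun y => ¬ (4 : ℤ) ∣ u'' y - sZ (f y)))) = 64 ∧
    ∀ m₀ ∈ ((V₀.image (bxor c)).filter fun y => ¬ (4 : ℤ) ∣ u'' y - sZ (f y)),
      ((V₀.image (bxor c)).filter fun y => ¬ (4 : ℤ) ∣ u'' y - sZ (f y)) =
        (V₀.filter (fun a => ∀ x ∈ ((V₀.image (bxor c)).filter fun y => ¬ (4 : ℤ) ∣ u'' y - sZ (f y)),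
          bxor x a ∈ ((V₀.image (bxor c)).filter fun y => ¬ (4 : ℤ) ∣ u'' y - sZ (f y)))).image (bxor m₀) := by
  classical
  set Z := univ.filter (fun x : Fin (6 + 6) → Bool => ¬ Odd (u'' x)) with hZdef
  set e : (Fin (6 + 6) → Bool) → ℤ := fun x => u'' x - sZ (f x) with hedef
  set M := (V₀.image (bxor c)).filter (fun y => ¬ (4 : ℤ) ∣ e y) with hMdef
  have hcardV9 : #V₀ = 2 ^ 9 := by rw [hcardV]; norm_num
  have hPV' : ∀ x, x ∉ Z → ∀ a ∈ V₀, bxor x a ∉ Z := fun x hx a ha => fl1_coset_out' hadd hS hx ha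
  have hcos_out : ∀ b ∈ V₀.image (bxor c), b ∉ Z := by
    intro b hb
    obtain ⟨v, hv, rfl⟩ := mem_image.1 hb
    exact hPV' c hc v hv
  have hcosV : ∀ x, x ∈ V₀.image (bxor c) → ∀ a ∈ V₀, bxor x a ∈ V₀.image (bxor c) :=
    fun x hx a ha => fl1_coset_vadd hadd rfl hx ha
  -- on the coset, `e − 2·1_M ≡ 0 (mod 4)`
  have hmod : ∀ y ∈ V₀.image (bxor c), (4 : ℤ) ∣ e y - (if y ∈ M then 2 else 0) := by
    intro y hy
    by_cases hyM : y ∈ M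
    · rw [if_pos hyM]
      have h4 := hM4 y hyM
      have : (e y - 2) * (e y + 2) = 0 := by
        show (u'' y - sZ (f y) - 2) * (u'' y - sZ (f y) + 2) = 0; nlinarith
      rcases mul_eq_zero.1 this with h | h
      · exact ⟨0, by linarith⟩
      · exact ⟨-1, by linarith⟩
    · rw [if_neg hyM, sub_zero]
      have := hM0 y (hcos_out y hy) hyM
      simp only [e]; rw [this]; exact dvd_zero _
  have heven : ∀ b ∈ V₀.image (bxor c), ∀ a : Fin (2 + 1 + 1) → Fin (6 + 6) → Bool, (∀ i, a i ∈ V₀) →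
      Even #(univ.filter fun ε : Fin (2 + 1 + 1) → Bool =>
        (fun j => b j ^^ decide (Odd #(univ.filter fun i => ε i && a i j))) ∈ M) := by
    intro b hb a ha
    have hpts : ∀ ε : Fin (2 + 1 + 1) → Bool, (fun j => b j ^^ decide (Odd #(univ.filter fun i => ε i && a i j))) ∈ V₀.image (bxor c) :=
      fun ε => ws_flatPt_mem V₀ h0 (· ∈ V₀.image (bxor c)) hcosV (2 + 1 + 1) b hb a ha ε
    have h4 := gh_line f g hf hg u'' hu'' V₀ xZ h0 hadd hcardV hS hoff b (a 0) (a 1) (a 2) (a 3) (ha 0) (ha 1) (ha 2) (ha 3)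
    have ea : (![a 0, a 1, a 2, a 3] : Fin 4 → Fin (6 + 6) → Bool) = a := by
      funext i; fin_cases i <;> rfl
    rw [ea] at h4
    change (4 : ℤ) ∣ ∑ ε : Fin (2 + 1 + 1) → Bool, e (fun j => b j ^^ decide (Odd #(univ.filter fun i => ε i && a i j))) at h4
    have hd : (4 : ℤ) ∣ ∑ ε : Fin (2 + 1 + 1) → Bool, (e (fun j => b j ^^ decide (Odd #(univ.filter fun i => ε i && a i j))) -
        (if (fun j => b j ^^ decide (Odd #(univ.filter fun i => ε i && a i j))) ∈ M then 2 else 0)) :=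
      dvd_sum fun ε _ => hmod _ (hpts ε)
    rw [sum_sub_distrib] at hd
    have h2 := (dvd_sub h4 hd)
    rw [sub_sub_cancel, ← sum_filter, sum_const, nsmul_eq_mul, mul_comm] at h2
    have h2' : (2 : ℤ) * 2 ∣ 2 * (#(univ.filter fun ε : Fin (2 + 1 + 1) → Bool =>
        (fun j => b j ^^ decide (Odd #(univ.filter fun i => ε i && a i j))) ∈ M) : ℤ) := by
      rw [show (2 : ℤ) * 2 = 4 by norm_num]; exact h2
    have h3 := (mul_dvd_mul_iff_left (two_ne_zero)).1 h2'
    exact (Int.even_coe_nat _).1 (even_iff_two_dvd.2 h3)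
  obtain ⟨h0U, haddU, hcardU, hcos⟩ := emf_flat_of_even_sections 9 2 V₀ h0 hadd hcardV9 c M (filter_subset _ _) heven
    (by rw [hM64]; norm_num)
  exact ⟨h0U, haddU, by rw [hcardU, hM64], hcos⟩

end Summit.QuantumAdvantage.QuantumAdvantage.Theorems.CubicForrelation.NearExactIsExact

end
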